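import Literature.AlgebraicTopology.SingularHomology.MayerVietorisExactness
import Literature.AlgebraicTopology.SingularHomology.ExcisionTheorem
import Literature.AlgebraicTopology.SingularHomology.ExcisionMayerVietorisProofs
import Literature.AlgebraicTopology.SingularHomology.LocalHomologyVanishing
import Literature.AlgebraicTopology.SingularHomology.SphereHomology
import Literature.AlgebraicTopology.SingularHomology.CollapseMap
import Mathlib.Algebra.Category.ModuleCat.Biproducts
import Mathlib.Geometry.Manifold.Instances.Sphere
import Mathlib.Analysis.Convex.Contractible
import HarnessLib

/-!
# The homology of `Sᵏ × Sˡ` below the top degree, by a vertical and a horizontal slice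

Topic `Literature/Topology/FourManifolds`; companion of `SphereProductMiddleHomology.lean`, which
computes `Hⱼ₊₁(Sᵏ) ⊕ Hⱼ₊₁(Sᵏ) ≅ Hⱼ₊₁(Sᵏ × Sᵏ)` (two factors of the SAME dimension) by Mayer–Vietoris.
Here the same argument is run for two spheres of ARBITRARY dimensions `k, l` (the generalities of
that file — Mayer–Vietoris with acyclic intersection, removing a point, contractible factors — are
re-proved as `private` lemmas so that this file depends only on the singular homology library) — A. Hatcher,
*Algebraic Topology* (2002), Example 3B.3 / Thm. 3B.6 (Künneth): `Hⱼ(Sᵏ × Sˡ; ℤ) ≅ ℤ` for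
`j ∈ {0, k, l, k + l}` (when `k ≠ l`), generated in degrees `k` and `l` by the slices `Sᵏ × q` and
`p × Sˡ` — PROVED without a Künneth theorem, exactly as in the sibling file: the punctured product
`Sᵏ × Sˡ ∖ (v, w)` is covered by `{x₁ ≠ v} ≅ (Sᵏ ∖ v) × Sˡ` and `{x₂ ≠ w} ≅ Sᵏ × (Sˡ ∖ w)` with
contractible intersection `(Sᵏ ∖ v) × (Sˡ ∖ w)`, and the puncture is invisible below degree
`k + l - 1` (local homology of the `(k+l)`-manifold `Sᵏ × Sˡ`). Everything is **proved**; no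
definition, no named fact (D-0026).

The mixed product `Sᵏ × Sᵏ⁻¹` is the "torus" `φ(Sᵏ × Sᵏ⁻¹)` of a spherical modification in the
middle dimension of a `2k`-manifold (M. Kervaire, J. Milnor, *Groups of homotopy spheres I*,
Ann. of Math. 77 (1963), Lemma 5.6 and p. 527: the classes `ε`, `ε'` of the "parallel"
`φ(Sᵏ × x₀)` and the "meridian" `φ(x₀ × Sᵏ⁻¹)`), which is what these computations serve
(the homology of one surgery in the proof of Lemma 7.1, toward the named fact
`Literature.Topology.FourManifolds.HomotopySphere.mk_eq_mk_iff_sigmaGen_dvd_sub`, Thm. 7.5).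

* `isIso_ψ_puncturedSphereProdMixed` — Mayer–Vietoris for the punctured product:
  `Hⱼ₊₁({x₁ ≠ v}) ⊕ Hⱼ₊₁({x₂ ≠ w}) ≅ Hⱼ₊₁(Sᵏ × Sˡ ∖ (v, w))`, `j ≥ 1`;
* `isIso_map_subsetIncl_puncturedSphereProdMixed` — filling in the puncture is an isomorphism on
  `Hⱼ₊₁` for `j + 1, j + 2 ≠ k + l`;
* `isIso_biprodDesc_slicesMixed_of_ne`, `isIso_biprodDesc_slicesMixed` — **the slice
  isomorphism** `Hⱼ₊₁(Sˡ) ⊕ Hⱼ₊₁(Sᵏ) ≅ Hⱼ₊₁(Sᵏ × Sˡ)`, `(x, y) ↦ (p, -)_* x + (-, q)_* y`, for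
  `1 ≤ j`, `j + 1, j + 2 ≠ k + l` (`k, l ≥ 1`);
* `isZero_singularHomology_sphereProdMixed` — `Hⱼ(Sᵏ × Sˡ; ℤ) = 0` for `2 ≤ j`, `j ∉ {k, l}`,
  `j + 1 < k + l`;
* `isIso_map_vertSliceMixed`, `isIso_map_sndMixed` — for `k ≠ l`, `l ≥ 2`, `k ≥ 2`: the vertical
  slice `y ↦ (p, y)` and the projection `pr₂` are isomorphisms `Hₗ(Sˡ) ≅ Hₗ(Sᵏ × Sˡ) ≅ Hₗ(Sˡ)`
  (the meridian class); `isIso_map_horizSliceMixed`, `isIso_map_fstMixed` — the same in degree `k`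
  for the horizontal slice and `pr₁` (the parallel class).

## References

* A. Hatcher, *Algebraic Topology*, CUP 2002: Ch. 0 p. 4, Cor. 2.11, Cor. 2.14, Thm. 2.16, §2.2
  pp. 149–150 (Mayer–Vietoris), §3.3 p. 231, Example 3B.3 and Thm. 3B.6 (Künneth; not used).
  [HatcherAT2002]
* M. Kervaire, J. Milnor, *Groups of homotopy spheres I*, Ann. of Math. 77 (1963), Lemma 5.6
  (pp. 514–516) and p. 527. [KervaireMilnorAnnals1963]
-/

noncomputable section

open CategoryTheory CategoryTheory.Limits Set Function Metric
open scoped Manifold Topology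

namespace Literature.Topology.FourManifolds

open Literature.AlgebraicTopology.SingularHomology

/-- Local notation: `𝕊 n` is the unit sphere in `EuclideanSpace ℝ (Fin (n + 1))`. -/
local notation "𝕊 " n:arg => (Metric.sphere (0 : EuclideanSpace ℝ (Fin (n + 1))) 1)

/-! ### Generalities (private copies of the lemmas of `SphereProductMiddleHomology.lean`) -/

section Generalities

variable {X : Type} [TopologicalSpace X]

/-- Mayer–Vietoris with an intersection acyclic in two consecutive degrees: `Hₙ₊₁(U) ⊞ Hₙ₊₁(V) ≅
Hₙ₊₁(X)` (Hatcher 2002, §2.2 p. 149). [cite: HatcherAT2002, §2.2 p. 149] -/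
private theorem mv_isIso_ψ_of_isZero (U V : Set X) (hU : IsOpen U) (hV : IsOpen V)
    (hUV : U ∪ V = univ) (n : ℕ) (h₁ : IsZero (singularHomology ℤ ℤ ↥(U ∩ V) (n + 1)))
    (h₀ : IsZero (singularHomology ℤ ℤ ↥(U ∩ V) n)) :
    IsIso (mayerVietoris.ψ ℤ ℤ U V (n + 1)) := by
  have hint : interior U ∪ interior V = univ := by rw [hU.interior_eq, hV.interior_eq, hUV]
  have hexc := relativeSingularHomology.isIso_map_of_interior_union_interior_holds ℤ ℤ X
  haveI : Mono (mayerVietoris.ψ ℤ ℤ U V (n + 1)) :=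
    (mayerVietoris.exact₁_holds ℤ ℤ U V hint (n + 1)).mono_g (h₁.eq_of_src _ _)
  haveI : Epi (mayerVietoris.ψ ℤ ℤ U V (n + 1)) :=
    (mayerVietoris.exact₂_holds ℤ ℤ U V hexc hint n).epi_f (h₀.eq_of_tgt _ _)
  exact isIso_of_mono_of_epi _

/-- Removing a point with vanishing local homology in degrees `n + 1, n + 2` does not change
`Hₙ₊₁` (Hatcher 2002, Thm. 2.16). [cite: HatcherAT2002, Thm. 2.16 with §3.3 p. 231] -/
private theorem isIso_map_subsetIncl_compl_singleton_aux (x : X) (n : ℕ)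
    (h₁ : IsZero (localHomology ℤ ℤ X x (n + 1))) (h₂ : IsZero (localHomology ℤ ℤ X x (n + 2))) :
    IsIso (singularHomology.map ℤ ℤ (subsetIncl ({x}ᶜ : Set X)) (n + 1)) := by
  haveI : Epi (singularHomology.map ℤ ℤ (subsetIncl ({x}ᶜ : Set X)) (n + 1)) :=
    (relativeSingularHomology.exact_map_ofAbsolute ℤ ℤ ({x}ᶜ : Set X) (n + 1)).epi_f
      (h₁.eq_of_tgt _ _)
  haveI : Mono (singularHomology.map ℤ ℤ (subsetIncl ({x}ᶜ : Set X)) (n + 1)) :=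
    (relativeSingularHomology.exact_δ_map ℤ ℤ ({x}ᶜ : Set X) (n + 1)).mono_g (h₂.eq_of_src _ _)
  exact isIso_of_mono_of_epi _

end Generalities

section Contractible

variable {C Y : Type} [TopologicalSpace C] [TopologicalSpace Y]

/-- A homotopy equivalence induces isomorphisms on singular homology (Hatcher 2002, Cor. 2.11).
[cite: HatcherAT2002, Cor. 2.11] -/
private theorem isIso_map_of_homotopyEquiv_aux (e : ContinuousMap.HomotopyEquiv C Y) (j : ℕ) :
    IsIso (singularHomology.map ℤ ℤ e.toFun j) := by
  refine ⟨⟨singularHomology.map ℤ ℤ e.invFun j, ?_, ?_⟩⟩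
  · rw [← singularHomology.map_comp, singularHomology.map_eq_of_homotopic ℤ ℤ e.left_inv j,
      singularHomology.map_id]
  · rw [← singularHomology.map_comp, singularHomology.map_eq_of_homotopic ℤ ℤ e.right_inv j,
      singularHomology.map_id]

/-- In a contractible space the identity is homotopic to every constant map. [folklore] -/
private theorem homotopic_id_const_aux [ContractibleSpace C] (c₀ : C) :
    (ContinuousMap.id C).Homotopic (ContinuousMap.const C c₀) := by
  obtain ⟨c₁, h₁⟩ := id_nullhomotopic C
  exact h₁.trans (ContinuousMap.homotopic_const_iff.2 (PathConnectedSpace.joined c₁ c₀))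

/-- For `C` contractible, `y ↦ (c₀, y) : Y → C × Y` induces isomorphisms on homology
(Hatcher 2002, Cor. 2.11). [cite: HatcherAT2002, Cor. 2.11] -/
private theorem isIso_map_prodMk_const_left_aux [ContractibleSpace C] (c₀ : C) (j : ℕ) :
    IsIso (singularHomology.map ℤ ℤ
      (⟨fun y => (c₀, y), Continuous.prodMk continuous_const continuous_id⟩ : C(Y, C × Y)) j) := by
  let e : ContinuousMap.HomotopyEquiv Y (C × Y) :=
    { toFun := ⟨fun y => (c₀, y), Continuous.prodMk continuous_const continuous_id⟩
      invFun := ⟨Prod.snd, continuous_snd⟩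
      left_inv := ContinuousMap.Homotopic.refl _
      right_inv := (homotopic_id_const_aux c₀).symm.prodMap
        (ContinuousMap.Homotopic.refl (ContinuousMap.id Y)) }
  exact isIso_map_of_homotopyEquiv_aux e j

/-- For `C` contractible, `y ↦ (y, c₀) : Y → Y × C` induces isomorphisms on homology
(Hatcher 2002, Cor. 2.11). [cite: HatcherAT2002, Cor. 2.11] -/
private theorem isIso_map_prodMk_const_right_aux [ContractibleSpace C] (c₀ : C) (j : ℕ) :
    IsIso (singularHomology.map ℤ ℤ
      (⟨fun y => (y, c₀), Continuous.prodMk continuous_id continuous_const⟩ : C(Y, Y × C)) j) := by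
  let e : ContinuousMap.HomotopyEquiv Y (Y × C) :=
    { toFun := ⟨fun y => (y, c₀), Continuous.prodMk continuous_id continuous_const⟩
      invFun := ⟨Prod.fst, continuous_fst⟩
      left_inv := ContinuousMap.Homotopic.refl _
      right_inv := (ContinuousMap.Homotopic.refl (ContinuousMap.id Y)).prodMap
        (homotopic_id_const_aux c₀).symm }
  exact isIso_map_of_homotopyEquiv_aux e j

end Contractible

/-- Precomposition with a homeomorphism preserves "induces an isomorphism on `Hⱼ`". [folklore] -/
private theorem isIso_map_homeomorph_comp_aux {A B Y : Type} [TopologicalSpace A]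
    [TopologicalSpace B] [TopologicalSpace Y] (φ : B ≃ₜ A) (g : C(Y, B)) (j : ℕ)
    [IsIso (singularHomology.map ℤ ℤ g j)] :
    IsIso (singularHomology.map ℤ ℤ ((φ : C(B, A)).comp g) j) := by
  rw [singularHomology.map_comp]
  haveI : IsIso (singularHomology.map ℤ ℤ (φ : C(B, A)) j) :=
    (singularHomology.mapIso ℤ ℤ φ j).isIso_hom
  infer_instance

/-- `Sᵏ` is path connected for `k ≥ 1`. [folklore] -/
private theorem pathConnectedSpace_unitSphere_aux {k : ℕ} (hk : 1 ≤ k) :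
    PathConnectedSpace (𝕊 k) := by
  have hrank : 1 < Module.rank ℝ (EuclideanSpace ℝ (Fin (k + 1))) := by
    apply Module.one_lt_rank_of_one_lt_finrank
    simp only [finrank_euclideanSpace, Fintype.card_fin]
    omega
  exact isPathConnected_iff_pathConnectedSpace.mp (isPathConnected_sphere hrank 0 zero_le_one)

section SphereProdMixed

variable {k l : ℕ}

/-- The punctured product `Sᵏ × Sˡ ∖ {(v, w)}` is covered by the two open sets `{x₁ ≠ v}`,
`{x₂ ≠ w}`. [folklore] -/
theorem union_fst_ne_snd_ne_mixed (v : 𝕊 k) (w : 𝕊 l) :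
    ({x | x.1.1 ≠ v} : Set ↥({((v, w) : (𝕊 k) × (𝕊 l))}ᶜ : Set ((𝕊 k) × (𝕊 l)))) ∪
      {x | x.1.2 ≠ w} = univ := by
  refine eq_univ_of_forall fun x => ?_
  by_contra h
  simp only [mem_union, mem_setOf_eq, not_or, not_not] at h
  exact x.2 (Prod.ext h.1 h.2)

/-- `{x₁ ≠ v} ∩ {x₂ ≠ w}` in the punctured product is homeomorphic to `(Sᵏ ∖ v) × (Sˡ ∖ w)`, hence
contractible. [folklore] -/
theorem contractibleSpace_fst_ne_inter_snd_ne_mixed (v : 𝕊 k) (w : 𝕊 l) :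
    ContractibleSpace ↥(({x | x.1.1 ≠ v} : Set ↥({((v, w) : (𝕊 k) × (𝕊 l))}ᶜ :
        Set ((𝕊 k) × (𝕊 l)))) ∩ {x | x.1.2 ≠ w}) := by
  haveI := contractibleSpace_sphere_compl_singleton (n := k) v
  haveI := contractibleSpace_sphere_compl_singleton (n := l) w
  let φ : ↥(({x | x.1.1 ≠ v} : Set ↥({((v, w) : (𝕊 k) × (𝕊 l))}ᶜ : Set ((𝕊 k) × (𝕊 l)))) ∩
        {x | x.1.2 ≠ w}) ≃ₜ (↥({v}ᶜ : Set (𝕊 k)) × ↥({w}ᶜ : Set (𝕊 l))) :=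
    { toFun := fun x => (⟨x.1.1.1, x.2.1⟩, ⟨x.1.1.2, x.2.2⟩)
      invFun := fun y => ⟨⟨(y.1.1, y.2.1), fun h => y.1.2 (congrArg Prod.fst h)⟩, y.1.2, y.2.2⟩
      left_inv := fun x => rfl
      right_inv := fun y => rfl
      continuous_toFun := by fun_prop
      continuous_invFun := by fun_prop }
  exact φ.contractibleSpace

/-- **`Hⱼ₊₁({x₁ ≠ v}) ⊕ Hⱼ₊₁({x₂ ≠ w}) ≅ Hⱼ₊₁(Sᵏ × Sˡ ∖ (v, w))`** for `j ≥ 1`: Mayer–Vietoris for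
the cover of the punctured product by `{x₁ ≠ v}` and `{x₂ ≠ w}`, whose intersection
`(Sᵏ ∖ v) × (Sˡ ∖ w)` is contractible (Hatcher 2002, §2.2, p. 149). [cite: HatcherAT2002, §2.2 p. 149] -/
theorem isIso_ψ_puncturedSphereProdMixed (v : 𝕊 k) (w : 𝕊 l) (j : ℕ) (hj : 1 ≤ j) :
    IsIso (mayerVietoris.ψ ℤ ℤ
      ({x | x.1.1 ≠ v} : Set ↥({((v, w) : (𝕊 k) × (𝕊 l))}ᶜ : Set ((𝕊 k) × (𝕊 l))))
      {x | x.1.2 ≠ w} (j + 1)) := by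
  haveI := contractibleSpace_fst_ne_inter_snd_ne_mixed (k := k) (l := l) v w
  refine mv_isIso_ψ_of_isZero _ _ ?_ ?_ (union_fst_ne_snd_ne_mixed v w) j ?_ ?_
  · exact (isOpen_compl_singleton.preimage continuous_fst).preimage continuous_subtype_val
  · exact (isOpen_compl_singleton.preimage continuous_snd).preimage continuous_subtype_val
  · exact isZero_singularHomology_of_contractibleSpace ℤ ℤ (Nat.succ_ne_zero j)
  · exact isZero_singularHomology_of_contractibleSpace ℤ ℤ (by omega)

/-- A chart of `Sᵏ × Sˡ` about any point with values in `ℝᵏ⁺ˡ`: the product of two charts of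
the spheres followed by `ℝᵏ × ℝˡ ≅ ℝᵏ⁺ˡ`. [folklore] -/
theorem exists_chart_sphereProdMixed (x : (𝕊 k) × (𝕊 l)) :
    ∃ e : OpenPartialHomeomorph ((𝕊 k) × (𝕊 l)) (RVec (k + l)), x ∈ e.source := by
  let c₁ := chartAt (EuclideanSpace ℝ (Fin k)) x.1
  let c₂ := chartAt (EuclideanSpace ℝ (Fin l)) x.2
  let θ : (EuclideanSpace ℝ (Fin k) × EuclideanSpace ℝ (Fin l)) ≃ₜ RVec (k + l) :=
    ((EuclideanSpace.equiv (Fin k) ℝ).toHomeomorph.prodCongr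
        (EuclideanSpace.equiv (Fin l) ℝ).toHomeomorph).trans
      ((Homeomorph.sumArrowHomeomorphProdArrow).symm.trans
        (Homeomorph.piCongrLeft (Y := fun _ => ℝ) finSumFinEquiv))
  refine ⟨(c₁.prod c₂).transHomeomorph θ, ?_⟩
  rw [OpenPartialHomeomorph.transHomeomorph_source, OpenPartialHomeomorph.prod_source]
  exact ⟨mem_chart_source _ x.1, mem_chart_source _ x.2⟩

/-- **Filling in the puncture: `Hⱼ₊₁(Sᵏ × Sˡ ∖ (v, w)) ≅ Hⱼ₊₁(Sᵏ × Sˡ)`** for `j + 1, j + 2 ≠ k + l`,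
by the exact sequence of the pair and the vanishing of the local homology of the `(k+l)`-manifold
`Sᵏ × Sˡ` in degrees `≠ k + l` (Hatcher 2002, Thm. 2.16 and §3.3 p. 231). [cite: HatcherAT2002, Thm. 2.16, §3.3 p. 231] -/
theorem isIso_map_subsetIncl_puncturedSphereProdMixed (v : 𝕊 k) (w : 𝕊 l) (j : ℕ)
    (h₁ : j + 1 ≠ k + l) (h₂ : j + 2 ≠ k + l) :
    IsIso (singularHomology.map ℤ ℤ
      (subsetIncl ({((v, w) : (𝕊 k) × (𝕊 l))}ᶜ : Set ((𝕊 k) × (𝕊 l)))) (j + 1)) := by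
  obtain ⟨e, he⟩ := exists_chart_sphereProdMixed (k := k) (l := l) ((v, w) : (𝕊 k) × (𝕊 l))
  exact isIso_map_subsetIncl_compl_singleton_aux _ j
    (isZero_localHomology_of_chart ℤ ℤ e he h₁) (isZero_localHomology_of_chart ℤ ℤ e he h₂)

/-- The vertical slice `y ↦ (c, y)` of `Sˡ` into the open piece `{x₁ ≠ v}` of the punctured
product (`c ≠ v`) induces isomorphisms on homology: the piece is `(Sᵏ ∖ v) × Sˡ` with `Sᵏ ∖ v`
contractible. [cite: HatcherAT2002, Cor. 2.11] -/
theorem isIso_map_vertSlice_fstNe_mixed (v : 𝕊 k) (w : 𝕊 l) (c : ↥({v}ᶜ : Set (𝕊 k))) (j : ℕ) :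
    IsIso (singularHomology.map ℤ ℤ (⟨fun y => ⟨⟨((c : 𝕊 k), y), fun h =>
        c.2 (congrArg Prod.fst h)⟩, c.2⟩, by fun_prop⟩ :
      C(𝕊 l, ↥({x | x.1.1 ≠ v} : Set ↥({((v, w) : (𝕊 k) × (𝕊 l))}ᶜ :
        Set ((𝕊 k) × (𝕊 l)))))) j) := by
  haveI := contractibleSpace_sphere_compl_singleton (n := k) v
  let φ : ↥({x | x.1.1 ≠ v} : Set ↥({((v, w) : (𝕊 k) × (𝕊 l))}ᶜ : Set ((𝕊 k) × (𝕊 l)))) ≃ₜ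
      (↥({v}ᶜ : Set (𝕊 k)) × (𝕊 l)) :=
    { toFun := fun x => (⟨x.1.1.1, x.2⟩, x.1.1.2)
      invFun := fun y => ⟨⟨((y.1 : 𝕊 k), y.2), fun h => y.1.2 (congrArg Prod.fst h)⟩, y.1.2⟩
      left_inv := fun x => rfl
      right_inv := fun y => rfl
      continuous_toFun := by fun_prop
      continuous_invFun := by fun_prop }
  have hfac : (⟨fun y => ⟨⟨((c : 𝕊 k), y), fun h => c.2 (congrArg Prod.fst h)⟩, c.2⟩, by fun_prop⟩ :
      C(𝕊 l, ↥({x | x.1.1 ≠ v} : Set ↥({((v, w) : (𝕊 k) × (𝕊 l))}ᶜ : Set ((𝕊 k) × (𝕊 l)))))) =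
      (φ.symm : C(_, _)).comp ⟨fun y => (c, y), Continuous.prodMk continuous_const continuous_id⟩ := by
    ext y <;> rfl
  rw [hfac]
  haveI := isIso_map_prodMk_const_left_aux (Y := 𝕊 l) c j
  exact isIso_map_homeomorph_comp_aux φ.symm _ j

/-- The horizontal slice `y ↦ (y, c)` of `Sᵏ` into the open piece `{x₂ ≠ w}` of the punctured
product (`c ≠ w`) induces isomorphisms on homology. [cite: HatcherAT2002, Cor. 2.11] -/
theorem isIso_map_horizSlice_sndNe_mixed (v : 𝕊 k) (w : 𝕊 l) (c : ↥({w}ᶜ : Set (𝕊 l))) (j : ℕ) :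
    IsIso (singularHomology.map ℤ ℤ (⟨fun y => ⟨⟨(y, (c : 𝕊 l)), fun h =>
        c.2 (congrArg Prod.snd h)⟩, c.2⟩, by fun_prop⟩ :
      C(𝕊 k, ↥({x | x.1.2 ≠ w} : Set ↥({((v, w) : (𝕊 k) × (𝕊 l))}ᶜ :
        Set ((𝕊 k) × (𝕊 l)))))) j) := by
  haveI := contractibleSpace_sphere_compl_singleton (n := l) w
  let φ : ↥({x | x.1.2 ≠ w} : Set ↥({((v, w) : (𝕊 k) × (𝕊 l))}ᶜ : Set ((𝕊 k) × (𝕊 l)))) ≃ₜ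
      ((𝕊 k) × ↥({w}ᶜ : Set (𝕊 l))) :=
    { toFun := fun x => (x.1.1.1, ⟨x.1.1.2, x.2⟩)
      invFun := fun y => ⟨⟨(y.1, (y.2 : 𝕊 l)), fun h => y.2.2 (congrArg Prod.snd h)⟩, y.2.2⟩
      left_inv := fun x => rfl
      right_inv := fun y => rfl
      continuous_toFun := by fun_prop
      continuous_invFun := by fun_prop }
  have hfac : (⟨fun y => ⟨⟨(y, (c : 𝕊 l)), fun h => c.2 (congrArg Prod.snd h)⟩, c.2⟩, by fun_prop⟩ :
      C(𝕊 k, ↥({x | x.1.2 ≠ w} : Set ↥({((v, w) : (𝕊 k) × (𝕊 l))}ᶜ : Set ((𝕊 k) × (𝕊 l)))))) =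
      (φ.symm : C(_, _)).comp ⟨fun y => (y, c), Continuous.prodMk continuous_id continuous_const⟩ := by
    ext y <;> rfl
  rw [hfac]
  haveI := isIso_map_prodMk_const_right_aux (Y := 𝕊 k) c j
  exact isIso_map_homeomorph_comp_aux φ.symm _ j

/-- **`Hⱼ₊₁(Sˡ) ⊕ Hⱼ₊₁(Sᵏ) ≅ Hⱼ₊₁(Sᵏ × Sˡ)` by a vertical and a horizontal slice**: for `c ≠ v` in
`Sᵏ` and `c' ≠ w` in `Sˡ`, the sum of `y ↦ (c, y)` (on `Hⱼ₊₁(Sˡ)`) and `y ↦ (y, c')` (on `Hⱼ₊₁(Sᵏ)`)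
is an isomorphism onto `Hⱼ₊₁(Sᵏ × Sˡ; ℤ)` whenever `1 ≤ j` and `j + 1, j + 2 ≠ k + l` —
Mayer–Vietoris for the punctured product, the slices being homotopy equivalences onto the two
pieces, and the puncture being invisible in these degrees. This is the Künneth computation of
`H_*(Sᵏ × Sˡ)` (Hatcher 2002, Example 3B.3 / Thm. 3B.6) below the top degree, proved by
Mayer–Vietoris. [cite: HatcherAT2002, §2.2 p. 149 and Thm. 3B.6] -/
theorem isIso_biprodDesc_slicesMixed_of_ne (v : 𝕊 k) (w : 𝕊 l) (c : ↥({v}ᶜ : Set (𝕊 k)))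
    (c' : ↥({w}ᶜ : Set (𝕊 l))) (j : ℕ) (hj : 1 ≤ j) (h₁ : j + 1 ≠ k + l) (h₂ : j + 2 ≠ k + l) :
    IsIso (biprod.desc
      (singularHomology.map ℤ ℤ (⟨fun y => ((c : 𝕊 k), y), by fun_prop⟩ : C(𝕊 l, (𝕊 k) × (𝕊 l)))
        (j + 1))
      (singularHomology.map ℤ ℤ (⟨fun y => (y, (c' : 𝕊 l)), by fun_prop⟩ : C(𝕊 k, (𝕊 k) × (𝕊 l)))
        (j + 1))) := by
  -- notation for the pieces of the punctured product
  set X : Set ((𝕊 k) × (𝕊 l)) := {((v, w) : (𝕊 k) × (𝕊 l))}ᶜ with hX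
  set U : Set ↥X := {x | x.1.1 ≠ v} with hU
  set V : Set ↥X := {x | x.1.2 ≠ w} with hV
  set sU : C(𝕊 l, ↥U) := ⟨fun y => ⟨⟨((c : 𝕊 k), y), fun h => c.2 (congrArg Prod.fst h)⟩, c.2⟩,
    by fun_prop⟩ with hsU
  set sV : C(𝕊 k, ↥V) := ⟨fun y => ⟨⟨(y, (c' : 𝕊 l)), fun h => c'.2 (congrArg Prod.snd h)⟩, c'.2⟩,
    by fun_prop⟩ with hsV
  haveI iU : IsIso (singularHomology.map ℤ ℤ sU (j + 1)) :=
    isIso_map_vertSlice_fstNe_mixed v w c (j + 1)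
  haveI iV : IsIso (singularHomology.map ℤ ℤ sV (j + 1)) :=
    isIso_map_horizSlice_sndNe_mixed v w c' (j + 1)
  haveI iψ : IsIso (mayerVietoris.ψ ℤ ℤ U V (j + 1)) := isIso_ψ_puncturedSphereProdMixed v w j hj
  haveI iX : IsIso (singularHomology.map ℤ ℤ (subsetIncl X) (j + 1)) :=
    isIso_map_subsetIncl_puncturedSphereProdMixed v w j h₁ h₂
  -- the sum of the slices factors through these isomorphisms
  have hfac : biprod.desc
      (singularHomology.map ℤ ℤ (⟨fun y => ((c : 𝕊 k), y), by fun_prop⟩ : C(𝕊 l, (𝕊 k) × (𝕊 l)))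
        (j + 1))
      (singularHomology.map ℤ ℤ (⟨fun y => (y, (c' : 𝕊 l)), by fun_prop⟩ : C(𝕊 k, (𝕊 k) × (𝕊 l)))
        (j + 1)) =
      biprod.map (singularHomology.map ℤ ℤ sU (j + 1)) (singularHomology.map ℤ ℤ sV (j + 1)) ≫
        mayerVietoris.ψ ℤ ℤ U V (j + 1) ≫ singularHomology.map ℤ ℤ (subsetIncl X) (j + 1) := by
    refine biprod.hom_ext' _ _ ?_ ?_
    · rw [biprod.inl_desc, biprod.inl_map_assoc, mayerVietoris.ψ, biprod.inl_desc_assoc,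
        ← singularHomology.map_comp, ← singularHomology.map_comp]
      rfl
    · rw [biprod.inr_desc, biprod.inr_map_assoc, mayerVietoris.ψ, biprod.inr_desc_assoc,
        ← singularHomology.map_comp, ← singularHomology.map_comp]
      rfl
  rw [hfac]
  haveI : IsIso (biprod.map (singularHomology.map ℤ ℤ sU (j + 1))
      (singularHomology.map ℤ ℤ sV (j + 1))) :=
    (biprod.mapIso (asIso (singularHomology.map ℤ ℤ sU (j + 1)))
      (asIso (singularHomology.map ℤ ℤ sV (j + 1)))).isIso_hom
  infer_instance

/-- All vertical slices `y ↦ (p, y)` of `Sᵏ × Sˡ` are homotopic (`k ≥ 1`). [folklore] -/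
theorem homotopic_vertSlice_mixed (hk : 1 ≤ k) (p p' : 𝕊 k) :
    (⟨fun y => (p, y), by fun_prop⟩ : C(𝕊 l, (𝕊 k) × (𝕊 l))).Homotopic ⟨fun y => (p', y), by fun_prop⟩ := by
  haveI := pathConnectedSpace_unitSphere_aux hk
  haveI : Nonempty (𝕊 l) := ⟨⟨EuclideanSpace.single 0 1, by simp⟩⟩
  obtain ⟨F⟩ : (ContinuousMap.const (𝕊 l) p).Homotopic (ContinuousMap.const (𝕊 l) p') :=
    ContinuousMap.homotopic_const_iff.2 (PathConnectedSpace.joined p p')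
  exact ⟨{ toFun := fun ty => (F ty, ty.2)
           continuous_toFun := F.continuous.prodMk continuous_snd
           map_zero_left := fun y => by simp
           map_one_left := fun y => by simp }⟩

/-- All horizontal slices `y ↦ (y, q)` of `Sᵏ × Sˡ` are homotopic (`l ≥ 1`). [folklore] -/
theorem homotopic_horizSlice_mixed (hl : 1 ≤ l) (q q' : 𝕊 l) :
    (⟨fun y => (y, q), by fun_prop⟩ : C(𝕊 k, (𝕊 k) × (𝕊 l))).Homotopic ⟨fun y => (y, q'), by fun_prop⟩ := by
  haveI := pathConnectedSpace_unitSphere_aux hl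
  haveI : Nonempty (𝕊 k) := ⟨⟨EuclideanSpace.single 0 1, by simp⟩⟩
  obtain ⟨F⟩ : (ContinuousMap.const (𝕊 k) q).Homotopic (ContinuousMap.const (𝕊 k) q') :=
    ContinuousMap.homotopic_const_iff.2 (PathConnectedSpace.joined q q')
  exact ⟨{ toFun := fun ty => (ty.2, F ty)
           continuous_toFun := continuous_snd.prodMk F.continuous
           map_zero_left := fun y => by simp
           map_one_left := fun y => by simp }⟩

/-- **`Hⱼ₊₁(Sˡ) ⊕ Hⱼ₊₁(Sᵏ) ≅ Hⱼ₊₁(Sᵏ × Sˡ)` by any vertical and any horizontal slice**: for all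
`p ∈ Sᵏ`, `q ∈ Sˡ` (`k, l ≥ 1`), `(x, y) ↦ (p, -)_* x + (-, q)_* y` is an isomorphism
`Hⱼ₊₁(Sˡ; ℤ) ⊕ Hⱼ₊₁(Sᵏ; ℤ) ≅ Hⱼ₊₁(Sᵏ × Sˡ; ℤ)` for `1 ≤ j`, `j + 1, j + 2 ≠ k + l` (puncture at the
antipodal point `(-p, -q)`; Hatcher 2002, Thm. 3B.6 for `Sᵏ × Sˡ`, here by Mayer–Vietoris).
[cite: HatcherAT2002, §2.2 p. 149, Cor. 2.11 and Thm. 3B.6] -/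
theorem isIso_biprodDesc_slicesMixed (p : 𝕊 k) (q : 𝕊 l) (j : ℕ)
    (hj : 1 ≤ j) (h₁ : j + 1 ≠ k + l) (h₂ : j + 2 ≠ k + l) :
    IsIso (biprod.desc
      (singularHomology.map ℤ ℤ (⟨fun y => (p, y), by fun_prop⟩ : C(𝕊 l, (𝕊 k) × (𝕊 l))) (j + 1))
      (singularHomology.map ℤ ℤ (⟨fun y => (y, q), by fun_prop⟩ : C(𝕊 k, (𝕊 k) × (𝕊 l))) (j + 1))) := by
  -- puncture at the antipodes `(-p, -q)`
  have hp : p ∈ ({-p}ᶜ : Set (𝕊 k)) := fun h =>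
    (ne_neg_of_mem_unit_sphere ℝ p) (mem_singleton_iff.1 h)
  have hq : q ∈ ({-q}ᶜ : Set (𝕊 l)) := fun h =>
    (ne_neg_of_mem_unit_sphere ℝ q) (mem_singleton_iff.1 h)
  exact isIso_biprodDesc_slicesMixed_of_ne (-p) (-q) ⟨p, hp⟩ ⟨q, hq⟩ j hj h₁ h₂

/-- **`Hⱼ(Sᵏ × Sˡ; ℤ) = 0` for `2 ≤ j`, `j ≠ k`, `j ≠ l`, `j + 1 < k + l`** (`k, l ≥ 1`): by the slice
isomorphism and `Hⱼ(Sᵏ) = Hⱼ(Sˡ) = 0` (Hatcher 2002, Cor. 2.14 and Example 3B.3).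
[cite: HatcherAT2002, Cor. 2.14, Thm. 3B.6] -/
theorem isZero_singularHomology_sphereProdMixed (hk : 1 ≤ k) (hl : 1 ≤ l) {j : ℕ} (hj : 2 ≤ j)
    (hjk : j ≠ k) (hjl : j ≠ l) (hj2 : j + 1 < k + l) :
    IsZero (singularHomology ℤ ℤ ((𝕊 k) × (𝕊 l)) j) := by
  obtain ⟨i, rfl⟩ : ∃ i, j = i + 1 := ⟨j - 1, by omega⟩
  obtain ⟨p⟩ : Nonempty (𝕊 k) := (pathConnectedSpace_unitSphere_aux hk).nonempty
  obtain ⟨q⟩ : Nonempty (𝕊 l) := (pathConnectedSpace_unitSphere_aux hl).nonempty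
  haveI := isIso_biprodDesc_slicesMixed p q i (by omega) (by omega) (by omega)
  have h0k : IsZero (singularHomology ℤ ℤ (𝕊 k) (i + 1)) :=
    isZero_singularHomology_sphere_holds ℤ ℤ (Nat.succ_ne_zero i) hjk
  have h0l : IsZero (singularHomology ℤ ℤ (𝕊 l) (i + 1)) :=
    isZero_singularHomology_sphere_holds ℤ ℤ (Nat.succ_ne_zero i) hjl
  have hb : IsZero (singularHomology ℤ ℤ (𝕊 l) (i + 1) ⊞ singularHomology ℤ ℤ (𝕊 k) (i + 1)) :=
    (biprod_isZero_iff _ _).2 ⟨h0l, h0k⟩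
  exact hb.of_iso (asIso (biprod.desc
    (singularHomology.map ℤ ℤ (⟨fun y => (p, y), Continuous.prodMk continuous_const continuous_id⟩ :
      C(𝕊 l, (𝕊 k) × (𝕊 l))) (i + 1))
    (singularHomology.map ℤ ℤ (⟨fun y => (y, q), Continuous.prodMk continuous_id continuous_const⟩ :
      C(𝕊 k, (𝕊 k) × (𝕊 l))) (i + 1)))).symm

/-- In a biproduct `A ⊞ B` with `B = 0`, if `biprod.desc f g` is an isomorphism then so is `f`
(`f = inl ≫ desc f g` and `inl` is an isomorphism when `B = 0`). [folklore] -/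
theorem isIso_of_isIso_biprodDesc_of_isZero_right {C : Type*} [Category C] [Preadditive C]
    {A B T : C} [HasBinaryBiproduct A B] (f : A ⟶ T) (g : B ⟶ T) (hB : IsZero B)
    [IsIso (biprod.desc f g)] : IsIso f := by
  have hsnd : (biprod.snd : A ⊞ B ⟶ B) = 0 := hB.eq_of_tgt _ _
  haveI : IsIso (biprod.inl : A ⟶ A ⊞ B) :=
    ⟨⟨biprod.fst, biprod.inl_fst, by rw [← biprod.total, hsnd, zero_comp, add_zero]⟩⟩
  rw [show f = biprod.inl ≫ biprod.desc f g from (biprod.inl_desc f g).symm]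
  infer_instance

/-- In a biproduct `A ⊞ B` with `A = 0`, if `biprod.desc f g` is an isomorphism then so is `g`.
[folklore] -/
theorem isIso_of_isIso_biprodDesc_of_isZero_left {C : Type*} [Category C] [Preadditive C]
    {A B T : C} [HasBinaryBiproduct A B] (f : A ⟶ T) (g : B ⟶ T) (hA : IsZero A)
    [IsIso (biprod.desc f g)] : IsIso g := by
  have hfst : (biprod.fst : A ⊞ B ⟶ A) = 0 := hA.eq_of_tgt _ _
  haveI : IsIso (biprod.inr : B ⟶ A ⊞ B) :=
    ⟨⟨biprod.snd, biprod.inr_snd, by rw [← biprod.total, hfst, zero_comp, zero_add]⟩⟩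
  rw [show g = biprod.inr ≫ biprod.desc f g from (biprod.inr_desc f g).symm]
  infer_instance

/-- **The meridian class: the vertical slice `y ↦ (p, y)` is an isomorphism
`Hₗ(Sˡ; ℤ) ≅ Hₗ(Sᵏ × Sˡ; ℤ)`** for `k ≠ l`, `k ≥ 2`, `l ≥ 2` (the other summand `Hₗ(Sᵏ)` of the
slice isomorphism vanishes; Hatcher 2002, Example 3B.3). For `(k, l) = (k, k - 1)` this is the
class `ε'` of the meridian `x₀ × Sᵏ⁻¹` of Kervaire–Milnor's torus `φ(Sᵏ × Sᵏ⁻¹)` (1963, p. 516).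
[cite: HatcherAT2002, Thm. 3B.6] [cite: KervaireMilnorAnnals1963, Lemma 5.6, proof (pp. 515–516)] -/
theorem isIso_map_vertSliceMixed (hk : 2 ≤ k) (hl : 2 ≤ l) (hkl : k ≠ l) (p : 𝕊 k) :
    IsIso (singularHomology.map ℤ ℤ (⟨fun y => (p, y), by fun_prop⟩ : C(𝕊 l, (𝕊 k) × (𝕊 l))) l) := by
  obtain ⟨i, rfl⟩ : ∃ i, l = i + 1 := ⟨l - 1, by omega⟩
  obtain ⟨q⟩ : Nonempty (𝕊 (i + 1)) := (pathConnectedSpace_unitSphere_aux (by omega)).nonempty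
  have hi : 1 ≤ i := by omega
  have h₁ : i + 1 ≠ k + (i + 1) := by omega
  have h₂ : i + 2 ≠ k + (i + 1) := by omega
  haveI := isIso_biprodDesc_slicesMixed (k := k) (l := i + 1) p q i hi h₁ h₂
  exact isIso_of_isIso_biprodDesc_of_isZero_right
    (singularHomology.map ℤ ℤ (⟨fun y => (p, y), Continuous.prodMk continuous_const continuous_id⟩ :
      C(𝕊 (i + 1), (𝕊 k) × (𝕊 (i + 1)))) (i + 1))
    (singularHomology.map ℤ ℤ (⟨fun y => (y, q), Continuous.prodMk continuous_id continuous_const⟩ :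
      C(𝕊 k, (𝕊 k) × (𝕊 (i + 1)))) (i + 1))
    (isZero_singularHomology_sphere_holds ℤ ℤ (Nat.succ_ne_zero i) (by omega))

/-- **The parallel class: the horizontal slice `y ↦ (y, q)` is an isomorphism
`Hₖ(Sᵏ; ℤ) ≅ Hₖ(Sᵏ × Sˡ; ℤ)`** for `k ≠ l`, `k ≥ 2`, `l ≥ 2` (Hatcher 2002, Example 3B.3). For
`(k, l) = (k, k - 1)` this is the class `ε` of the parallel `Sᵏ × x₀` of Kervaire–Milnor's torus
(1963, p. 516). [cite: HatcherAT2002, Thm. 3B.6] [cite: KervaireMilnorAnnals1963, Lemma 5.6, proof (pp. 515–516)] -/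
theorem isIso_map_horizSliceMixed (hk : 2 ≤ k) (hl : 2 ≤ l) (hkl : k ≠ l) (q : 𝕊 l) :
    IsIso (singularHomology.map ℤ ℤ (⟨fun y => (y, q), by fun_prop⟩ : C(𝕊 k, (𝕊 k) × (𝕊 l))) k) := by
  obtain ⟨i, rfl⟩ : ∃ i, k = i + 1 := ⟨k - 1, by omega⟩
  obtain ⟨p⟩ : Nonempty (𝕊 (i + 1)) := (pathConnectedSpace_unitSphere_aux (by omega)).nonempty
  have hi : 1 ≤ i := by omega
  have h₁ : i + 1 ≠ i + 1 + l := by omega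
  have h₂ : i + 2 ≠ i + 1 + l := by omega
  haveI := isIso_biprodDesc_slicesMixed (k := i + 1) (l := l) p q i hi h₁ h₂
  exact isIso_of_isIso_biprodDesc_of_isZero_left
    (singularHomology.map ℤ ℤ (⟨fun y => (p, y), Continuous.prodMk continuous_const continuous_id⟩ :
      C(𝕊 l, (𝕊 (i + 1)) × (𝕊 l))) (i + 1))
    (singularHomology.map ℤ ℤ (⟨fun y => (y, q), Continuous.prodMk continuous_id continuous_const⟩ :
      C(𝕊 (i + 1), (𝕊 (i + 1)) × (𝕊 l))) (i + 1))
    (isZero_singularHomology_sphere_holds ℤ ℤ (Nat.succ_ne_zero i) (by omega))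

/-- **The projection `pr₂ : Sᵏ × Sˡ → Sˡ` is an isomorphism on `Hₗ`** (`k ≠ l`, `k, l ≥ 2`): it is a
left inverse of the vertical slice, which is an isomorphism (`isIso_map_vertSliceMixed`).
[cite: HatcherAT2002, Thm. 3B.6] -/
theorem isIso_map_sndMixed (hk : 2 ≤ k) (hl : 2 ≤ l) (hkl : k ≠ l) :
    IsIso (singularHomology.map ℤ ℤ (ContinuousMap.snd : C((𝕊 k) × (𝕊 l), 𝕊 l)) l) := by
  obtain ⟨p⟩ : Nonempty (𝕊 k) := (pathConnectedSpace_unitSphere_aux (by omega)).nonempty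
  haveI := isIso_map_vertSliceMixed hk hl hkl p
  have hcomp : singularHomology.map ℤ ℤ (⟨fun y => (p, y), by fun_prop⟩ : C(𝕊 l, (𝕊 k) × (𝕊 l))) l ≫
      singularHomology.map ℤ ℤ (ContinuousMap.snd : C((𝕊 k) × (𝕊 l), 𝕊 l)) l = 𝟙 _ := by
    rw [← singularHomology.map_comp]
    exact singularHomology.map_id ℤ ℤ l
  exact IsIso.of_isIso_fac_left hcomp

/-- **The projection `pr₁ : Sᵏ × Sˡ → Sᵏ` is an isomorphism on `Hₖ`** (`k ≠ l`, `k, l ≥ 2`): it is a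
left inverse of the horizontal slice (`isIso_map_horizSliceMixed`). [cite: HatcherAT2002, Thm. 3B.6] -/
theorem isIso_map_fstMixed (hk : 2 ≤ k) (hl : 2 ≤ l) (hkl : k ≠ l) :
    IsIso (singularHomology.map ℤ ℤ (ContinuousMap.fst : C((𝕊 k) × (𝕊 l), 𝕊 k)) k) := by
  obtain ⟨q⟩ : Nonempty (𝕊 l) := (pathConnectedSpace_unitSphere_aux (by omega)).nonempty
  haveI := isIso_map_horizSliceMixed hk hl hkl q
  have hcomp : singularHomology.map ℤ ℤ (⟨fun y => (y, q), by fun_prop⟩ : C(𝕊 k, (𝕊 k) × (𝕊 l))) k ≫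
      singularHomology.map ℤ ℤ (ContinuousMap.fst : C((𝕊 k) × (𝕊 l), 𝕊 k)) k = 𝟙 _ := by
    rw [← singularHomology.map_comp]
    exact singularHomology.map_id ℤ ℤ k
  exact IsIso.of_isIso_fac_left hcomp

/-- **A map `Sᵏ × Sˡ → Y` which kills the horizontal slice kills `Hₖ`** (`k ≠ l`, `k, l ≥ 2`): if
`(f ∘ (-, q))_* = 0` on `Hₖ(Sᵏ)` then `f_* = 0` on `Hₖ(Sᵏ × Sˡ)`, the slice being onto `Hₖ`.
[folklore] -/
theorem map_eq_zero_of_comp_horizSlice_eq_zero (hk : 2 ≤ k) (hl : 2 ≤ l) (hkl : k ≠ l)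
    {Y : Type} [TopologicalSpace Y] (f : C((𝕊 k) × (𝕊 l), Y)) (q : 𝕊 l)
    (h : singularHomology.map ℤ ℤ (f.comp (⟨fun y => (y, q), by fun_prop⟩ : C(𝕊 k, (𝕊 k) × (𝕊 l)))) k
      = 0) :
    singularHomology.map ℤ ℤ f k = 0 := by
  haveI := isIso_map_horizSliceMixed hk hl hkl q
  rw [singularHomology.map_comp] at h
  rw [← cancel_epi (singularHomology.map ℤ ℤ
    (⟨fun y => (y, q), by fun_prop⟩ : C(𝕊 k, (𝕊 k) × (𝕊 l))) k), h, comp_zero]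

/-- **A map `Sᵏ × Sˡ → Y` which kills the vertical slice kills `Hₗ`** (`k ≠ l`, `k, l ≥ 2`).
[folklore] -/
theorem map_eq_zero_of_comp_vertSlice_eq_zero (hk : 2 ≤ k) (hl : 2 ≤ l) (hkl : k ≠ l)
    {Y : Type} [TopologicalSpace Y] (f : C((𝕊 k) × (𝕊 l), Y)) (p : 𝕊 k)
    (h : singularHomology.map ℤ ℤ (f.comp (⟨fun y => (p, y), by fun_prop⟩ : C(𝕊 l, (𝕊 k) × (𝕊 l)))) l
      = 0) :
    singularHomology.map ℤ ℤ f l = 0 := by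
  haveI := isIso_map_vertSliceMixed hk hl hkl p
  rw [singularHomology.map_comp] at h
  rw [← cancel_epi (singularHomology.map ℤ ℤ
    (⟨fun y => (p, y), by fun_prop⟩ : C(𝕊 l, (𝕊 k) × (𝕊 l))) l), h, comp_zero]

end SphereProdMixed

end Literature.Topology.FourManifolds

end
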